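import Summits.AtomisticToContinuum.Crystallization.Theses.ExcessDecayLiouville
import Literature.Probability.Process.LocalRubberHardCore
import Literature.MathematicalPhysics.StatisticalMechanics.RootEnergy
import Literature.MathematicalPhysics.StatisticalMechanics.LocalLimitOfGroundStates

/-!
# Skeleton line `hcp-free-phase-exclusion` for crux `CoarseGrains` (stmt-AtomisticToContinuum-9331)

Route `ExcessDecayLiouville`, sub-problem `Crystallization`.  Crux-plan skeleton (planner
`cruxplan-stmt-AtomisticToContinuum-9331-hcp-free-phase-exclusion`): three registered stubs
`stub_*` (sorried), the sorry-free composition `coarseGrains_of_hyps : BSCompactness →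
EnergyUpperBound → PalmCoarseHcp → ⟨crux unfolded⟩` (axioms propext / Classical.choice /
Quot.sound) and `CoarseGrains_of`, whose conclusion is literally the route decl
`Summit.AtomisticToContinuum.Crystallization.Theses.ExcessDecayLiouville.CoarseGrains`
(`coarseGrains_iff` is `Iff.rfl`) and whose only sorries are the three stubs.

## The line in one paragraph ("kill phases, not clusters")

Contrapositive.  If `CoarseGrains` fails at radius `R`, there are Lennard-Jones ground states
`x_k` with `n_k ≥ k` particles and NO `(1/40, R)`-grain.  Root each `x_k` at a uniformly chosen
particle: along a subsequence the rooted empirical laws converge (Benjamini–Schramm) to a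
probability law `P` on rooted `δ`-hard-core configurations of `ℝ³` that is POINT-STATIONARY
(Mecke / mass-transport identity — exact at finite `N`), carried by local limits of translated
ground states (the class `𝔏`, `IsLocalLimitOfGroundStates`), whose mean root energy is
`lim E(n_{k_j})/n_{k_j}` and which transfers positive-probability matching events back to a positive
FRACTION of particles (`stub_bsCompactness`, the indexation-free form of item 9230).  By the
trial-state bound `limsup E(N)/N ≤ e* := ⨅_Q e(Q)` (`stub_energyUpperBound` = item 11865/0629) the
law is MINIMISING, `E_P[h] ≤ e*`.  The load-bearing stub `stub_palmCoarseHcp` (the idea's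
Transfer `C⁺ = PalmCoarseHcp`) says such a law gives positive (outer) probability to the event
"some ball of radius `R + 1` is two-way `(1/41)`-matched with an admissible affine hcp two-lattice"
— no minimising point-stationary hard-core phase is hcp-free.  The margin `1/41 + 1/1640 = 1/40`
and the radius loss `R + 1 → R` make that event survive a `(L + R + 1, 1/1640)` local matching
(`near_of_locallyMatches`, PROVED here), so some particle of some grain-free `x_k` carries a
`(1/40, R)`-grain after translating back (`near_translate`, PROVED) — contradiction.

Why the Palm side is easier than the finite-`N` crux (idea card + TRIAGE-r1-1 §B): stationarity is
EXACT (no boundary layer, no `N^{2/3}` bookkeeping), the energy `P ↦ E_P[h]` is LINEAR, so every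
competing phase dies by a strict energy-density inequality without rates, and `C⁺` only asks for
grains with POSITIVE probability at ONE tolerance — it tolerates positive densities of vacancies
and stacking faults and does not need the optimal cell to be unique (contrast `PalmRigidity`
9224: a.s. EXACT relaxed hcp).  Sandwich: `PalmRigidity` (9224) + the certified window pin
`AdmissiblePin` below ⇒ `C⁺` ⇒ `CoarseGrains` (this file) — so progress on route
`PalmUnimodularRigidity` closes the load-bearing stub, not conversely.

## Disproof used

No `Cruxes/CoarseGrains/Disproof.lean` has been published (checked `ledger crux ls
stmt-AtomisticToContinuum-9331`, 2026-08-16: only `TRIAGE-r1-1.md`); no `_false_without_` theorem,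
tightness lemma or landed `Theorems/CoarseGrains/Negative/` lemma exists to honour or import.
Negatives index (12 refuted statements, `ledger negatives`): the two Crystallization entries are
4146 `EffectiveLocalHales` (decahedral soft shell — no local-Hales certificate is used here) and
3506 `OneGrainGluing` (refuted by PILING particles on one site: multiplicity-blind matching of
non-separated configurations); every configuration in this file is an injective ground state or a
`δ`-hard-core rooted configuration, so the piling witness is excluded by hypothesis.
-/

noncomputable section

open MeasureTheory Filter Set Topology
open Literature.MathematicalPhysics.StatisticalMechanics
open Literature.Probability.Process

namespace Summit.AtomisticToContinuum.Crystallization.Cruxes.CoarseGrains.HcpFreePhaseExclusion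

/-! ### Vocabulary of the line (transparent packaging of the crux's `let`s) -/

/-- Ambient space. -/
abbrev E3 : Type := EuclideanSpace ℝ (Fin 3)

/-- The period lattice `Λ = ℤu + ℤv + ℤ·2√(2/3)e₃` of the unit hcp stacking (verbatim the
crux's `let Λ`). -/
def hcpΛ : Set E3 :=
  {z | ∃ i j k : ℤ, z = (i : ℝ) • triangularVec₁ 1 + (j : ℝ) • triangularVec₂ 1 +
    (k : ℝ) • layerNormal (2 * Real.sqrt (2 / 3))}

/-- Two-way `ε`-matching on the ball `B_r(c)` of a point set `X` with the affine hcp two-lattice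
`{t m + A z : m ∈ {0,1}, z ∈ Λ}` (verbatim the crux's `let Near`). -/
def Near (X : Set E3) (c : E3) (r : ℝ) (t : Fin 2 → E3) (A : E3 →L[ℝ] E3) (ε : ℝ) : Prop :=
  (∀ p ∈ X, dist p c ≤ r → ∃ m : Fin 2, ∃ z ∈ hcpΛ, dist p (t m + A z) ≤ ε) ∧
    (∀ m : Fin 2, ∀ z ∈ hcpΛ, dist (t m + A z) c ≤ r → ∃ p ∈ X, dist p (t m + A z) ≤ ε)

/-- Admissible cell: within `1/40` (operator norm) of `0.97·O(3)` (verbatim the crux's `let Adm`). -/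
def Adm (A : E3 →L[ℝ] E3) : Prop :=
  ∃ R : E3 ≃ₗᵢ[ℝ] E3, ‖A - (97 / 100 : ℝ) • (R.toContinuousLinearEquiv : E3 →L[ℝ] E3)‖ ≤ 1 / 40

/-- hcp-like inner displacement of the two sublattices (verbatim the crux's `let Inner`). -/
def Inner (t : Fin 2 → E3) (A : E3 →L[ℝ] E3) : Prop :=
  ‖t 1 - t 0 - A (barlowOffset 1 + layerNormal (Real.sqrt (2 / 3)))‖ ≤ 1 / 40

/-- The reference energy `e* = ⨅` over periodic configurations of the LJ energy per particle. -/
def eStar : ℝ :=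
  ⨅ Q : PeriodicConfiguration 3, Q.energyPerParticle lennardJones

/-- **The hcp-grain event at radius `R`** (tolerance `1/41`, radius `R + 1`): the rooted
configurations `ν` (as measures; points = `atoms ν`) containing, ANYWHERE, a ball of radius
`R + 1` two-way `(1/41)`-matched with an admissible affine hcp two-lattice with hcp-like inner
displacement.  "hcp-free at `(1/41, R+1)`" is the complement. -/
def GrainEvent (R : ℝ) : Set (Measure E3) :=
  {ν | ∃ (c : E3) (t : Fin 2 → E3) (A : E3 →L[ℝ] E3),
    Adm A ∧ Inner t A ∧ Near (atoms ν) c (R + 1) t A (1 / 41)}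

/-- The crux, unfolded into the vocabulary of this file (definitional). -/
theorem coarseGrains_iff :
    Summit.AtomisticToContinuum.Crystallization.Theses.ExcessDecayLiouville.CoarseGrains ↔
      ∀ R : ℝ, 0 < R → ∃ N₀ : ℕ, ∀ N : ℕ, N₀ ≤ N → ∀ x : Fin N → E3,
        IsGroundState lennardJones x →
          ∃ (c : E3) (t : Fin 2 → E3) (A : E3 →L[ℝ] E3),
            Adm A ∧ Inner t A ∧ Near (Set.range x) c R t A (1 / 40) :=
  Iff.rfl

/-- **The window pin** (documentation of the sandwich `PalmRigidity (9224) → C⁺`, NOT used in the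
composition; a certified lattice-sum computation, kit-able): every relaxed hcp in the box
`[1/2, 2]²` whose energy per particle attains `e*` has spacing `a` and reduced layer height
`h / √(2/3)` within `1/40` of `0.97`.  Float check (kit job j007600, evidence on the crux item; lattice sums
reproduce Stillinger's `A₆ = 14.45490`, `A₁₂ = 12.13229`): the minimum of `e(hcp a h)` over the box is
`−0.717580` at `(a*, h*) = (0.9719, 0.7921)`, `h*/√(2/3) = 0.9701`, and the minimum OUTSIDE the window is
`−0.714522` (soft c-axis edge), margin `3.06·10⁻³ ≈ 44×` the hcp–fcc gap — certifiable by interval arithmetic.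
With it, an a.s. exact relaxed hcp law charges `GrainEvent R` with mass one for every `R`
(`A' = A ∘ diag(a, a, h/√(2/3))`, `‖A' − 0.97 A‖ = max (|a − 0.97|, |h/√(2/3) − 0.97|) ≤ 1/40`,
inner displacement exact). -/
def AdmissiblePin : Prop :=
  ∀ a h : ℝ, ∀ (ha : a ≠ 0) (hh : h ≠ 0), 1 / 2 ≤ a → a ≤ 2 → 1 / 2 ≤ h → h ≤ 2 →
    (hcpPeriodicConfiguration ha hh).energyPerParticle lennardJones = eStar →
      |a - 97 / 100| ≤ 1 / 40 ∧ |h / Real.sqrt (2 / 3) - 97 / 100| ≤ 1 / 40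

/-! ### The three stub statements, named (`BSCompactness`, `EnergyUpperBound`, `PalmCoarseHcp`)

The composition `coarseGrains_of_hyps : BSCompactness → EnergyUpperBound → PalmCoarseHcp → ⟨CoarseGrains,
unfolded⟩` is sorry-free; each registered stub `stub_*` below restates its statement verbatim, and the kernel
checks the agreement in `CoarseGrains_of`, the ONLY theorem of this file concluding the crux decl by name (so the
skeleton audit has a unique candidate). -/

/-- **Statement of `stub_bsCompactness`** (Benjamini–Schramm compactness with energy and density transfer, for an
ARBITRARILY INDEXED family of ground states; size XL, soft).  For ground states `x k` with
`n k → ∞` particles there are a subsequence `φ`, a hard core `δ > 0` and a probability law `P` on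
rooted configurations (`Measure E3`; points = `atoms`) which is (i) a.s. rooted `δ`-hard-core,
(ii) point-stationary (Mecke identity `IsPointStationaryLaw`), (iii) a.s. carried by the class `𝔏`
of local limits of translated LJ ground states, (iv) has mean root energy
`E_P[rootEnergy] = lim_j E(n (φ j)) / n (φ j)`, and (v) is a LOCAL LIMIT in density-transfer
(portmanteau) form: for every set `T` of configurations, radius `R'`, tolerance `ε > 0` and
`ρ < P(T)`, eventually at least `ρ · n (φ j)` particles `i` of `x (φ j)` have their recentred
configuration `(R', ε)`-matched both ways with some `ν ∈ T`.  This is item 9230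
(`PalmUnimodularRigidity.BenjaminiSchrammLimit`) with the indexation `N ↦ n k` freed (TRIAGE-r1-1
§B sharpen (1): 9230 as typed returns its own subsequence of an `∀N`-family and may dodge the
grain-free particle numbers) and clause (iii) added.  Proof plan: `P_k := (1/n_k) Σ_i δ_{count|
(x_k − x_k i)}` on the compact metric space `LocalConfig.RootedHardCoreConfig E3 (1/3)`
(`LennardJonesMinimalDistance_holds`, `RootedHardCoreConfig.ofFinite`, `instCompactSpace`);
Prokhorov; mass transport is an exact finite double count and passes to the limit for bounded
continuous local `g`, then monotone class (`IsPointStationaryLaw`); `E_{P_k}[h] = E(n_k)/n_k`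
exactly (`interactionEnergy_div_eq_avg_rootEnergy_lennardJones`) and `h` is a uniform limit of
bounded continuous local functionals under the hard core (`continuous_integral_toMeasure`, tail
`≤ C R⁻³`); the support of the limit lies in the closed class `𝔏`
(`IsLocalLimitOfGroundStates.of_eventually_ballMatch`, needs `n k → ∞` and padding by
`LennardJonesGroundStatesExist_holds`); transfer by portmanteau on the open fattenings
`LocalConfig.isOpen_setOf_locallyMatches`, pushed to `Measure E3` along `LocalConfig.toMeasure`
(`measurable_toMeasure`).  Hidden cost: clause (v) quantifies over ARBITRARY `T` (outer measure),
so the prover must show that `toMeasure` on rooted `δ`-hard-core configurations is a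
`MeasurableEmbedding` (its range `{count|S : 0 ∈ S, S δ-separated}` is Giry-measurable — integer
values on a countable ring force a purely atomic measure), whence `map f Q T = Q (f ⁻¹' T)` for all
`T`; `Measure.le_map_apply` alone gives the wrong inequality. -/
def BSCompactness : Prop :=
  ∀ (n : ℕ → ℕ) (x : (k : ℕ) → (Fin (n k) → E3)), Tendsto n atTop atTop →
      (∀ k, IsGroundState lennardJones (x k)) →
      ∃ φ : ℕ → ℕ, StrictMono φ ∧ ∃ δ : ℝ, 0 < δ ∧ ∃ P : Measure (Measure E3),
        IsProbabilityMeasure P ∧ (∀ᵐ μ ∂P, IsRootedHardCore δ μ) ∧ IsPointStationaryLaw P ∧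
        (∀ᵐ μ ∂P, IsLocalLimitOfGroundStates lennardJones 3 (atoms μ)) ∧
        Tendsto (fun j : ℕ => groundStateEnergy lennardJones 3 (n (φ j)) / (n (φ j) : ℝ)) atTop
          (𝓝 (∫ μ, rootEnergy lennardJones μ ∂P)) ∧
        ∀ (T : Set (Measure E3)) (R' ε : ℝ), 0 < ε → ∀ ρ : ℝ, ρ < (P T).toReal →
          ∀ᶠ j : ℕ in atTop, ρ * (n (φ j) : ℝ) ≤
            (Nat.card {i : Fin (n (φ j)) // ∃ ν ∈ T,
              LocallyMatches R' ε (Set.range fun k : Fin (n (φ j)) => x (φ j) k - x (φ j) i)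
                (atoms ν)} : ℝ)

/-- **Statement of `stub_energyUpperBound`** (trial-state upper bound; size M, provable now — the signature of
the shared item `CrysEnergyUpper`, stmt-11865 / stmt-0629, implied by `CrysEnergyLimit` 0626):
`limsup_N E(N)/N ≤ e* = ⨅_Q e(Q)`.  Finite blocks `Q.points ∩ [−L, L]³` of a periodic `Q` are
injective trial configurations with `E ≤ #block · e(Q) + o(#block)` (boundary `O(L²)` sites, each
with bounded LJ field by the `r⁻⁶` tail; interior sites lose only the tail beyond distance
`dist(·, ∂)`), particle numbers between consecutive blocks are filled by far-away extra particles
at non-positive cost (`V ≤ 0` beyond `r = 2^{-1/6}`); `le_ciInf`. -/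
def EnergyUpperBound : Prop :=
  Filter.limsup (fun N : ℕ =>
        Literature.MathematicalPhysics.StatisticalMechanics.groundStateEnergy
          Literature.MathematicalPhysics.StatisticalMechanics.lennardJones 3 N / N) Filter.atTop ≤
      ⨅ Q : Literature.MathematicalPhysics.StatisticalMechanics.PeriodicConfiguration 3,
        Q.energyPerParticle Literature.MathematicalPhysics.StatisticalMechanics.lennardJones

/-- **Statement `PalmCoarseHcp` of `stub_palmCoarseHcp`** (THE LOAD-BEARING STUB — the idea's
Transfer `C⁺`; crystallization-strength, open).  For every radius `R > 0` and hard core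
`δ > 0`: a probability law `P` on rooted configurations of `ℝ³` which is a.s. rooted
`δ`-hard-core, POINT-STATIONARY, a.s. carried by local limits of translated LJ ground states
(`𝔏`), and MINIMISING (`E_P[rootEnergy V_LJ] ≤ e* = ⨅_Q e(Q)`; the root's own term is
`V_LJ(0) = 0` in Lean, `lennardJones_zero`) gives POSITIVE (outer) probability to the hcp-grain
event `GrainEvent R` — "no minimising point-stationary hard-core phase is hcp-free at
`(1/41, R + 1)`".  Why plausible (idea card; TRIAGE-r1-1 §B junk-model audit): every candidate
hcp-free competitor is non-minimising by a STRICT energy-density inequality, linear in `P` — the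
rooted single point and re-rooted finite clusters (`E > e*` since two far copies of a cluster
attract), cluster gases / cracked or slab hcp (particle-weighted averages of those), fcc and
polytypes (`e_fcc − e* ≈ 7·10⁻⁵`, Hägg margin for faulted stackings), elastically modulated
defect-free hcp (`c·E[strain²] > 0`); positive densities of vacancies or faults are ALLOWED (they
leave `R`-grains with positive probability), which is what makes `C⁺` weaker than `PalmRigidity`
(9224, a.s. exact hcp): 9224 + `AdmissiblePin` ⇒ this stub.  Foreseen attack (layer below, the
prover's choice): ergodic decomposition + `UnimodularEnergyLowerBound` (9229, `e_uni ≥ e*`) reduce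
to ergodic minimising laws; then either the coercivity inequality
`E_P[h] − e* ≥ κ_R · P(no grain centred within 1 of the root)` over point-stationary hard-core laws
(an affine inequality on a convex set: Palm-side `HcpDefectCoercivity` 14476 with bending priced by
elastic energy density, cf. `FrustrationRangeLP`), or local structure a.s. (`MinimiserShells` 9225
+ stacking at three-layer radius) + globalisation (`ShellsToBarlowChart` 9227) + elastic flatness
with positive probability.  Why it might fail: an amorphous / polytetrahedral or fcc-grained
minimising phase (barriers `IcosahedralClusters`, `TetrahedralFrustration`,
`ShortRangeStackingBlindness` apply here and only here). -/
def PalmCoarseHcp : Prop :=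
  ∀ R : ℝ, 0 < R → ∀ δ : ℝ, 0 < δ → ∀ P : Measure (Measure E3), IsProbabilityMeasure P →
      (∀ᵐ μ ∂P, IsRootedHardCore δ μ) → IsPointStationaryLaw P →
      (∀ᵐ μ ∂P, IsLocalLimitOfGroundStates lennardJones 3 (atoms μ)) →
      (∫ μ, rootEnergy lennardJones μ ∂P) ≤ eStar →
      0 < P (GrainEvent R)

/-! ### Registered stubs -/

/-- **stub_bsCompactness** — registered stub, statement `BSCompactness` verbatim (size XL, soft; the
indexation-free form of item 9230 plus the `𝔏`-support clause). -/
theorem stub_bsCompactness :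
    ∀ (n : ℕ → ℕ) (x : (k : ℕ) → (Fin (n k) → E3)), Tendsto n atTop atTop →
      (∀ k, IsGroundState lennardJones (x k)) →
      ∃ φ : ℕ → ℕ, StrictMono φ ∧ ∃ δ : ℝ, 0 < δ ∧ ∃ P : Measure (Measure E3),
        IsProbabilityMeasure P ∧ (∀ᵐ μ ∂P, IsRootedHardCore δ μ) ∧ IsPointStationaryLaw P ∧
        (∀ᵐ μ ∂P, IsLocalLimitOfGroundStates lennardJones 3 (atoms μ)) ∧
        Tendsto (fun j : ℕ => groundStateEnergy lennardJones 3 (n (φ j)) / (n (φ j) : ℝ)) atTop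
          (𝓝 (∫ μ, rootEnergy lennardJones μ ∂P)) ∧
        ∀ (T : Set (Measure E3)) (R' ε : ℝ), 0 < ε → ∀ ρ : ℝ, ρ < (P T).toReal →
          ∀ᶠ j : ℕ in atTop, ρ * (n (φ j) : ℝ) ≤
            (Nat.card {i : Fin (n (φ j)) // ∃ ν ∈ T,
              LocallyMatches R' ε (Set.range fun k : Fin (n (φ j)) => x (φ j) k - x (φ j) i)
                (atoms ν)} : ℝ) := by
  sorry

/-- **stub_energyUpperBound** — registered stub, statement `EnergyUpperBound` verbatim (size M, provable
now; literally the signature of the shared item `CrysEnergyUpper`, stmt-11865 / stmt-0629). -/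
theorem stub_energyUpperBound :
    Filter.limsup (fun N : ℕ =>
        Literature.MathematicalPhysics.StatisticalMechanics.groundStateEnergy
          Literature.MathematicalPhysics.StatisticalMechanics.lennardJones 3 N / N) Filter.atTop ≤
      ⨅ Q : Literature.MathematicalPhysics.StatisticalMechanics.PeriodicConfiguration 3,
        Q.energyPerParticle Literature.MathematicalPhysics.StatisticalMechanics.lennardJones := by
  sorry

/-- **stub_palmCoarseHcp** — registered stub, statement `PalmCoarseHcp` verbatim (THE
LOAD-BEARING STUB, the idea's Transfer `C⁺ = PalmCoarseHcp`; crystallization-strength). -/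
theorem stub_palmCoarseHcp :
    ∀ R : ℝ, 0 < R → ∀ δ : ℝ, 0 < δ → ∀ P : Measure (Measure E3), IsProbabilityMeasure P →
      (∀ᵐ μ ∂P, IsRootedHardCore δ μ) → IsPointStationaryLaw P →
      (∀ᵐ μ ∂P, IsLocalLimitOfGroundStates lennardJones 3 (atoms μ)) →
      (∫ μ, rootEnergy lennardJones μ ∂P) ≤ eStar →
      0 < P (GrainEvent R) := by
  sorry

/-! ### Proved glue 1: `E(N)/N ≤ 0` (the sequence in `stub_energyUpperBound` is bounded above) -/

/-- `V_LJ(r) ≤ 0` for `r ≥ 1` (`V = (1/12)s² − (1/6)s`, `s = r⁻⁶ ∈ [0, 1]`). -/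
theorem lennardJones_nonpos_of_one_le {r : ℝ} (hr : 1 ≤ r) : lennardJones r ≤ 0 := by
  have h0 : 0 ≤ r⁻¹ := inv_nonneg.2 (zero_le_one.trans hr)
  have h1 : r⁻¹ ≤ 1 := inv_le_one_of_one_le₀ hr
  have hs0 : 0 ≤ (r⁻¹) ^ 6 := pow_nonneg h0 6
  have hs1 : (r⁻¹) ^ 6 ≤ 1 := pow_le_one₀ h0 h1
  have h12 : (r⁻¹) ^ 12 = ((r⁻¹) ^ 6) ^ 2 := by ring
  unfold lennardJones
  rw [h12]
  nlinarith [mul_le_mul_of_nonneg_left hs1 hs0]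

/-- A spread-out trial configuration: `N` points on a line at mutual distances `≥ 2` have
non-positive Lennard-Jones energy, so `E(N) ≤ 0`. -/
theorem groundStateEnergy_lennardJones_nonpos (N : ℕ) : groundStateEnergy lennardJones 3 N ≤ 0 := by
  obtain ⟨e, he⟩ : ∃ e : E3, ‖e‖ = 1 := exists_norm_eq E3 zero_le_one
  have he0 : e ≠ 0 := by
    intro h
    rw [h, norm_zero] at he
    exact zero_ne_one he
  let x : Fin N → E3 := fun i => ((2 : ℝ) * (i : ℕ)) • e
  have hx : Function.Injective x := by
    intro i j hij
    have h2 : (2 : ℝ) * (i : ℕ) = (2 : ℝ) * (j : ℕ) := smul_left_injective ℝ he0 hij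
    have h3 : ((i : ℕ) : ℝ) = ((j : ℕ) : ℝ) := by linarith
    exact Fin.ext (Nat.cast_injective h3)
  have hdist : ∀ i j : Fin N, i ≠ j → 1 ≤ dist (x i) (x j) := by
    intro i j hij
    have hne : (i : ℕ) ≠ (j : ℕ) := fun h => hij (Fin.ext h)
    have hd : dist (x i) (x j) = |(2 : ℝ) * (i : ℕ) - 2 * (j : ℕ)| := by
      change dist (((2 : ℝ) * (i : ℕ)) • e) (((2 : ℝ) * (j : ℕ)) • e) = _
      rw [dist_eq_norm, ← sub_smul, norm_smul, he, mul_one, Real.norm_eq_abs]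
    rw [hd]
    rcases Nat.lt_or_gt_of_ne hne with h | h
    · have h' : ((i : ℕ) : ℝ) + 1 ≤ ((j : ℕ) : ℝ) := by exact_mod_cast h
      rw [abs_of_nonpos (by linarith)]
      linarith
    · have h' : ((j : ℕ) : ℝ) + 1 ≤ ((i : ℕ) : ℝ) := by exact_mod_cast h
      rw [abs_of_nonneg (by linarith)]
      linarith
  have hE : interactionEnergy lennardJones x ≤ 0 := by
    unfold interactionEnergy
    refine Finset.sum_nonpos fun i _ => Finset.sum_nonpos fun j hj => ?_
    have hij : i ≠ j := (Finset.mem_Ioi.1 hj).ne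
    exact lennardJones_nonpos_of_one_le (hdist i j hij)
  exact (groundStateEnergy_lennardJones_le hx).trans hE

/-- Hence `E(N)/N ≤ 0`. -/
theorem groundStateEnergy_div_nonpos (N : ℕ) :
    groundStateEnergy lennardJones 3 N / (N : ℝ) ≤ 0 :=
  div_nonpos_of_nonpos_of_nonneg (groundStateEnergy_lennardJones_nonpos N) (Nat.cast_nonneg N)

/-! ### Proved glue 2: translation covariance and the margin portmanteau `1/41 + 1/1640 = 1/40` -/

/-- `Inner` only sees the inner displacement `t 1 − t 0`: translating both sublattices is free. -/
theorem inner_translate {t : Fin 2 → E3} {A : E3 →L[ℝ] E3} (v : E3) (h : Inner t A) :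
    Inner (fun m => t m + v) A := by
  unfold Inner at h ⊢
  have : t 1 + v - (t 0 + v) = t 1 - t 0 := by abel
  rw [this]
  exact h

/-- **Translation covariance of `Near`**: a grain of the configuration recentred at `x i` is a
grain of the configuration itself, with centre and sublattice translations shifted by `x i`. -/
theorem near_translate {N : ℕ} (x : Fin N → E3) (i : Fin N) {c : E3} {r : ℝ} {t : Fin 2 → E3}
    {A : E3 →L[ℝ] E3} {ε : ℝ} (h : Near (Set.range fun k => x k - x i) c r t A ε) :
    Near (Set.range x) (c + x i) r (fun m => t m + x i) A ε := by
  constructor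
  · rintro p ⟨k, rfl⟩ hpc
    have h1 : x k - x i ∈ Set.range fun k => x k - x i := ⟨k, rfl⟩
    have h2 : dist (x k - x i) c ≤ r := by
      rwa [dist_sub_eq_dist_add, add_comm]
    obtain ⟨m, z, hz, hd⟩ := h.1 _ h1 h2
    refine ⟨m, z, hz, ?_⟩
    have : t m + x i + A z = x i + (t m + A z) := by abel
    rwa [this, ← dist_sub_eq_dist_add]
  · intro m z hz hd
    have hd' : dist (t m + A z) c ≤ r := by
      have : t m + x i + A z = (t m + A z) + x i := by abel
      rwa [this, dist_add_right] at hd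
    obtain ⟨p, ⟨k, rfl⟩, hpk⟩ := h.2 m z hz hd'
    refine ⟨x k, ⟨k, rfl⟩, ?_⟩
    have : t m + x i + A z = x i + (t m + A z) := by abel
    rwa [this, ← dist_sub_eq_dist_add]

/-- **Margin portmanteau** (TRIAGE-r1-1: `T_{1/41,R+1} ⊂ int T_{1/40,R}`): if the points of `ν`
carry a `(η, R + 1)`-grain centred at `c` with `‖c‖ ≤ L`, and `X` is two-way `ε`-matched with
the points of `ν` on the ball `‖·‖ ≤ R'`, `R' ≥ L + R + 1`, `ε, η ≤ 1`, then `X`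
carries the `(η', R)`-grain with the SAME datum `(c, t, A)` whenever `η + ε ≤ η'`. -/
theorem near_of_locallyMatches {X : Set E3} {ν : Measure E3} {c : E3} {t : Fin 2 → E3}
    {A : E3 →L[ℝ] E3} {L R R' ε η η' : ℝ} (hε : ε ≤ 1) (hη : η ≤ 1)
    (hR' : L + R + 1 ≤ R') (hsum : η + ε ≤ η') (hc : ‖c‖ ≤ L)
    (hν : Near (atoms ν) c (R + 1) t A η) (hm : LocallyMatches R' ε X (atoms ν)) :
    Near X c R t A η' := by
  constructor
  · intro p' hp' hp'c
    -- a particle of `X` in `B_R(c)` is `ε`-close to a point of `ν` in `B_{R+1}(c)`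
    have hnorm : ‖p'‖ ≤ R' := by
      have h1 : ‖p'‖ ≤ dist p' c + ‖c‖ := by
        have := norm_le_norm_add_norm_sub' p' c
        calc ‖p'‖ = ‖(p' - c) + c‖ := by rw [sub_add_cancel]
          _ ≤ ‖p' - c‖ + ‖c‖ := norm_add_le _ _
          _ = dist p' c + ‖c‖ := by rw [dist_eq_norm]
      linarith
    obtain ⟨p, hp, hpp'⟩ := hm.2 p' hp' hnorm
    have hpc : dist p c ≤ R + 1 := by
      have := dist_triangle p p' c
      rw [dist_comm p p'] at this
      linarith
    obtain ⟨m, z, hz, hd⟩ := hν.1 p hp hpc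
    refine ⟨m, z, hz, ?_⟩
    have := dist_triangle p' p (t m + A z)
    linarith
  · intro m z hz hsc
    -- a site in `B_R(c)` has a point of `ν` within `η`, which has a particle of `X` within `ε`
    have hsc' : dist (t m + A z) c ≤ R + 1 := by linarith
    obtain ⟨p, hp, hps⟩ := hν.2 m z hz hsc'
    have hnorm : ‖p‖ ≤ R' := by
      calc ‖p‖ = ‖(p - (t m + A z)) + ((t m + A z) - c) + c‖ := by congr 1; abel
        _ ≤ ‖p - (t m + A z)‖ + ‖(t m + A z) - c‖ + ‖c‖ := norm_add₃_le
        _ = dist p (t m + A z) + dist (t m + A z) c + ‖c‖ := by rw [dist_eq_norm, dist_eq_norm]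
        _ ≤ η + R + L := by linarith
        _ ≤ R' := by linarith
    obtain ⟨q, hq, hqp⟩ := hm.1 p hp hnorm
    refine ⟨q, hq, ?_⟩
    have := dist_triangle q p (t m + A z)
    linarith

/-! ### The composition -/

/-- **Composition** (sorry-free, standard axioms).  The three stub statements imply the crux — stated
here in the unfolded form of `coarseGrains_iff` so that `CoarseGrains_of` below is the unique theorem of the
file whose conclusion is the route decl itself. -/
theorem coarseGrains_of_hyps (hBS : BSCompactness) (hUp : EnergyUpperBound) (hEx : PalmCoarseHcp) :
    ∀ R : ℝ, 0 < R → ∃ N₀ : ℕ, ∀ N : ℕ, N₀ ≤ N → ∀ x : Fin N → E3,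
      IsGroundState lennardJones x →
        ∃ (c : E3) (t : Fin 2 → E3) (A : E3 →L[ℝ] E3),
          Adm A ∧ Inner t A ∧ Near (Set.range x) c R t A (1 / 40) := by
  unfold BSCompactness at hBS
  unfold EnergyUpperBound at hUp
  unfold PalmCoarseHcp at hEx
  intro R hR
  by_contra H
  push Not at H
  -- grain-free ground states `x N₀` with `n N₀ ≥ N₀` particles
  choose n hn x hx hbad using H
  have hn' : Tendsto n atTop atTop := tendsto_atTop_mono hn tendsto_id
  obtain ⟨φ, hφ, δ, hδ, P, hP, hcore, hstat, hLL, hE, htr⟩ := hBS n x hn' hx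
  haveI := hP
  -- (1) the Benjamini–Schramm limit law is minimising
  have hmin : (∫ μ, rootEnergy lennardJones μ ∂P) ≤ eStar := by
    refine le_trans ?_ hUp
    have hv : Tendsto (fun j : ℕ => n (φ j)) atTop atTop := hn'.comp hφ.tendsto_atTop
    have hcomp : Filter.limsup ((fun N : ℕ => groundStateEnergy lennardJones 3 N / (N : ℝ)) ∘
        fun j : ℕ => n (φ j)) atTop ≤
        Filter.limsup (fun N : ℕ => groundStateEnergy lennardJones 3 N / (N : ℝ)) atTop :=
      hv.limsup_comp_le_limsup (tendsto_map'_iff.2 hE).isCoboundedUnder_le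
        (isBoundedUnder_of ⟨0, fun N => groundStateEnergy_div_nonpos N⟩)
    rw [← hE.limsup_eq]
    exact hcomp
  -- (2) phase exclusion: the grain event has positive mass, hence so does a localised piece
  have hpos : 0 < P (GrainEvent R) := hEx R hR δ hδ P hP hcore hstat hLL hmin
  set T : ℕ → Set (Measure E3) := fun L => {ν | ∃ c : E3, ‖c‖ ≤ (L : ℝ) ∧
    ∃ (t : Fin 2 → E3) (A : E3 →L[ℝ] E3), Adm A ∧ Inner t A ∧
      Near (atoms ν) c (R + 1) t A (1 / 41)} with hTdef
  have hsub : GrainEvent R ⊆ ⋃ L : ℕ, T L := by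
    rintro ν ⟨c, t, A, hA, hI, hN⟩
    exact Set.mem_iUnion.2 ⟨⌈‖c‖⌉₊, c, Nat.le_ceil _, t, A, hA, hI, hN⟩
  obtain ⟨L, hL⟩ : ∃ L : ℕ, P (T L) ≠ 0 := by
    by_contra hall
    push Not at hall
    have h0 : P (⋃ L : ℕ, T L) = 0 := (measure_iUnion_null_iff).2 hall
    exact hpos.ne' (measure_mono_null hsub h0)
  -- (3) density transfer along the subsequence
  have hTtop : P (T L) ≠ ⊤ := measure_ne_top P _
  have hρ : 0 < (P (T L)).toReal := ENNReal.toReal_pos hL hTtop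
  obtain ⟨j, hj1, hj⟩ := ((eventually_ge_atTop 1).and
    (htr (T L) ((L : ℝ) + R + 1) (1 / 1640) (by norm_num) ((P (T L)).toReal / 2)
      (half_lt_self hρ))).exists
  have hnj : (1 : ℝ) ≤ (n (φ j) : ℝ) := by
    have : 1 ≤ n (φ j) := hj1.trans ((hφ.id_le j).trans (hn (φ j)))
    exact_mod_cast this
  have hcard : (0 : ℝ) < Nat.card {i : Fin (n (φ j)) // ∃ ν ∈ T L,
      LocallyMatches ((L : ℝ) + R + 1) (1 / 1640)
        (Set.range fun k : Fin (n (φ j)) => x (φ j) k - x (φ j) i) (atoms ν)} := by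
    have : 0 < (P (T L)).toReal / 2 * (n (φ j) : ℝ) := by positivity
    linarith
  have hne : Nonempty {i : Fin (n (φ j)) // ∃ ν ∈ T L,
      LocallyMatches ((L : ℝ) + R + 1) (1 / 1640)
        (Set.range fun k : Fin (n (φ j)) => x (φ j) k - x (φ j) i) (atoms ν)} := by
    have h' : Nat.card {i : Fin (n (φ j)) // ∃ ν ∈ T L,
        LocallyMatches ((L : ℝ) + R + 1) (1 / 1640)
          (Set.range fun k : Fin (n (φ j)) => x (φ j) k - x (φ j) i) (atoms ν)} ≠ 0 := by
      intro h0
      rw [h0, Nat.cast_zero] at hcard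
      exact lt_irrefl _ hcard
    exact (Nat.card_ne_zero.1 h').1
  obtain ⟨⟨i, ν, hνT, hmatch⟩⟩ := hne
  obtain ⟨c, hc, t, A, hA, hI, hN⟩ := hνT
  -- (4) margin portmanteau and translation back: particle `i` carries a `(1/40, R)`-grain
  have hgrain : Near (Set.range fun k : Fin (n (φ j)) => x (φ j) k - x (φ j) i) c R t A (1 / 40) :=
    near_of_locallyMatches (by norm_num) (by norm_num) le_rfl (by norm_num) hc hN hmatch
  exact hbad (φ j) (c + x (φ j) i) (fun m => t m + x (φ j) i) A hA (inner_translate _ hI)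
    (near_translate (x (φ j)) i hgrain)

/-- **The crux BY NAME from the registered stubs.**  The kernel checks here that each `stub_*` states its
named statement verbatim (definitional unfolding) and that the composition reaches the route decl
`ExcessDecayLiouville.CoarseGrains` (`coarseGrains_iff` is `Iff.rfl`); the only `sorry`s in its cone are the
three stubs. -/
theorem CoarseGrains_of :
    Summit.AtomisticToContinuum.Crystallization.Theses.ExcessDecayLiouville.CoarseGrains :=
  coarseGrains_iff.2 (coarseGrains_of_hyps stub_bsCompactness stub_energyUpperBound stub_palmCoarseHcp)

end Summit.AtomisticToContinuum.Crystallization.Cruxes.CoarseGrains.HcpFreePhaseExclusion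

end
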